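import Summits.QuantumFields.YangMills.Theorems.ColdStartUniversalityLatticeLangevinFiniteDimensionalLaws
import Summits.QuantumFields.YangMills.Theorems.ColdStartUniversalityLatticeLangevinWilsonReversibleMeasurable
import HarnessLib

/-!
# Route `ColdStartUniversality` (fixed-cut-off SZZ dynamics): ★★ TIME-REVERSAL INVARIANCE OF THE STATIONARY SZZ PROCESS —
# detailed balance at the level of ALL finite-dimensional distributions

Helper file (seat `ym-line-csu-p1`, g33; `--supports stmt-QuantumFields-24809`).  The one-step detailed balance of THE transition kernels with respect to
the Wilson–Gibbs measure (`integral_mul_transition_symm_su2_of_measurable`: `∫ F·κ_tG dμ = ∫ G·κ_tF dμ`, seat g15/g16) iterates along the Markov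
chain of the kernels (file 47: the finite-dimensional distributions of every strong solution are `K_(t₁)f₁⋯K_(t_n)f_n`, `(K_t f h)(y) = ∫ f·h dκ_t(y)`):
* ★★ `integral_mul_foldr_transition_eq_reverse` — for bounded measurable `a, b, f₁, …, f_n` and increments `t₁, …, t_n`:
  `∫ a · (K_(t₁)M_(f₁) ⋯ K_(t_n)M_(f_n) b) dμ_(β') = ∫ b · (M_(f_n)K_(t_n) ⋯ M_(f₁)K_(t₁) a) dμ_(β')` — the operator string is reversed (both strings are
  `List.foldr`s, over `l` and over `l.reverse`; no definition);
* ★★ `stationary_fdd_reverse` — with `b = 1`: the stationary multi-time correlation `E_μ[a(X_0) f₁(X_(t₁)) ⋯ f_n(X_(t₁+⋯+t_n))]` equals the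
  correlation of the REVERSED itinerary — the stationary SZZ process (Wilson–Gibbs start) is REVERSIBLE: its law is invariant under time reversal.
THEOREMS ONLY, no definition, no sorry; [folklore] (Kolmogorov's reversibility criterion for symmetric semigroups).  HONEST FRAMING: fixed cut-off;
`UniformColdStartMixing` (24809) is NOT restated; no crux, rung or summit statement is proved; the Yang–Mills mass gap is NOT proved.
-/

set_option autoImplicit false

noncomputable section

namespace Summit.QuantumFields.YangMills.Theorems.ColdStartUniversality

open MeasureTheory ProbabilityTheory Filter Topology
open scoped NNReal ENNReal BigOperators
open Literature Literature.Probability.Process Literature.MathematicalPhysics.QuantumFieldTheory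
open Literature.MathematicalPhysics.QuantumLattice (fundamentalRep fundamentalLatticeRep continuous_fundamentalRep)

variable {L : ℕ} [NeZero L]

/-! ## §1. The two operator strings (as `List.foldr`s): measurability and bounds -/

omit [NeZero L] in
/-- `K_(t₁)M_(f₁)⋯K_(t_n)M_(f_n) b` is measurable and bounded for bounded measurable data. [folklore] -/
theorem measurable_bounded_foldr_KM
    (κ : ℝ≥0 → Kernel (GaugeConfig 3 L (Matrix.specialUnitaryGroup (Fin 2) ℂ))
      (GaugeConfig 3 L (Matrix.specialUnitaryGroup (Fin 2) ℂ))) [∀ t, IsMarkovKernel (κ t)]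
    {b : GaugeConfig 3 L (Matrix.specialUnitaryGroup (Fin 2) ℂ) → ℝ} (hbm : Measurable b) (hbb : ∃ C : ℝ, ∀ z, |b z| ≤ C) :
    ∀ (l : List (ℝ≥0 × (GaugeConfig 3 L (Matrix.specialUnitaryGroup (Fin 2) ℂ) → ℝ))),
      (∀ p ∈ l, Measurable p.2) → (∀ p ∈ l, ∃ C : ℝ, ∀ z, |p.2 z| ≤ C) →
      Measurable (l.foldr (fun p acc => fun y => ∫ z, p.2 z * acc z ∂(κ p.1 y)) b) ∧
        ∃ C : ℝ, ∀ y, |(l.foldr (fun p acc => fun y => ∫ z, p.2 z * acc z ∂(κ p.1 y)) b) y| ≤ C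
  | [], _, _ => ⟨by simpa using hbm, by simpa using hbb⟩
  | p :: l, hm, hb => by
    obtain ⟨ihm, Cl, hCl⟩ := measurable_bounded_foldr_KM κ hbm hbb l (fun q hq => hm q (List.mem_cons_of_mem _ hq))
      (fun q hq => hb q (List.mem_cons_of_mem _ hq))
    obtain ⟨Cp, hCp⟩ := hb p List.mem_cons_self
    have hpm : Measurable p.2 := hm p List.mem_cons_self
    rw [List.foldr_cons]
    refine ⟨((hpm.mul ihm).stronglyMeasurable.integral_kernel (κ := κ p.1)).measurable, Cp * Cl, fun y => ?_⟩
    have hh := norm_integral_le_of_norm_le_const (μ := κ p.1 y) (C := Cp * Cl)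
      (f := fun z => p.2 z * (l.foldr (fun p acc => fun y => ∫ z, p.2 z * acc z ∂(κ p.1 y)) b) z)
      (Eventually.of_forall fun z => by
        rw [norm_mul, Real.norm_eq_abs, Real.norm_eq_abs]
        exact mul_le_mul (hCp z) (hCl z) (abs_nonneg _) ((abs_nonneg _).trans (hCp z)))
    simpa [Real.norm_eq_abs] using hh

omit [NeZero L] in
/-- `M_(f₁)K_(t₁)⋯M_(f_n)K_(t_n) a` is measurable and bounded for bounded measurable data. [folklore] -/
theorem measurable_bounded_foldr_MK
    (κ : ℝ≥0 → Kernel (GaugeConfig 3 L (Matrix.specialUnitaryGroup (Fin 2) ℂ))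
      (GaugeConfig 3 L (Matrix.specialUnitaryGroup (Fin 2) ℂ))) [∀ t, IsMarkovKernel (κ t)]
    {a : GaugeConfig 3 L (Matrix.specialUnitaryGroup (Fin 2) ℂ) → ℝ} (ham : Measurable a) (hab : ∃ C : ℝ, ∀ z, |a z| ≤ C) :
    ∀ (l : List (ℝ≥0 × (GaugeConfig 3 L (Matrix.specialUnitaryGroup (Fin 2) ℂ) → ℝ))),
      (∀ p ∈ l, Measurable p.2) → (∀ p ∈ l, ∃ C : ℝ, ∀ z, |p.2 z| ≤ C) →
      Measurable (l.foldr (fun p acc => fun y => p.2 y * ∫ z, acc z ∂(κ p.1 y)) a) ∧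
        ∃ C : ℝ, ∀ y, |(l.foldr (fun p acc => fun y => p.2 y * ∫ z, acc z ∂(κ p.1 y)) a) y| ≤ C
  | [], _, _ => ⟨by simpa using ham, by simpa using hab⟩
  | p :: l, hm, hb => by
    obtain ⟨ihm, Cl, hCl⟩ := measurable_bounded_foldr_MK κ ham hab l (fun q hq => hm q (List.mem_cons_of_mem _ hq))
      (fun q hq => hb q (List.mem_cons_of_mem _ hq))
    obtain ⟨Cp, hCp⟩ := hb p List.mem_cons_self
    have hpm : Measurable p.2 := hm p List.mem_cons_self
    rw [List.foldr_cons]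
    refine ⟨hpm.mul (ihm.stronglyMeasurable.integral_kernel (κ := κ p.1)).measurable, Cp * Cl, fun y => ?_⟩
    have hh := norm_integral_le_of_norm_le_const (μ := κ p.1 y) (C := Cl)
      (f := fun z => (l.foldr (fun p acc => fun y => p.2 y * ∫ z, acc z ∂(κ p.1 y)) a) z)
      (Eventually.of_forall fun z => by rw [Real.norm_eq_abs]; exact hCl z)
    rw [abs_mul]
    exact mul_le_mul (hCp y) (by simpa [Real.norm_eq_abs] using hh) (abs_nonneg _) ((abs_nonneg _).trans (hCp y))

/-! ## §2. Reversal of the operator string under the Wilson–Gibbs pairing -/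

/-- ★★ **Detailed balance iterated: the operator string is reversed under the `μ_(β')`-pairing.**  For every realising kernel family `κ`, bounded
measurable `a, b` and every list `[(t₁,f₁),…,(t_n,f_n)]` of increments and bounded measurable observables:
`∫ a·(K_(t₁)M_(f₁)⋯K_(t_n)M_(f_n) b) dμ_(β') = ∫ b·(M_(f_n)K_(t_n)⋯M_(f₁)K_(t₁) a) dμ_(β')`. [folklore] -/
theorem integral_mul_foldr_transition_eq_reverse (L : ℕ) [NeZero L] (β' : ℝ)
    (κ : ℝ≥0 → Kernel (GaugeConfig 3 L (Matrix.specialUnitaryGroup (Fin 2) ℂ))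
      (GaugeConfig 3 L (Matrix.specialUnitaryGroup (Fin 2) ℂ))) [∀ t, IsMarkovKernel (κ t)]
    (hreal : ∀ (t : ℝ≥0) (x : GaugeConfig 3 L (Matrix.specialUnitaryGroup (Fin 2) ℂ))
        (Ω : Type) [MeasurableSpace Ω] (P : Measure Ω) [IsProbabilityMeasure P]
        (W : ℝ≥0 → Ω → (Edge 3 L × NoiseIdx 2 → ℝ)) (hW : IsFlatBrownian W P)
        (U : ℝ≥0 → Ω → GaugeConfig 3 L (Matrix.specialUnitaryGroup (Fin 2) ℂ)),
        (∀ ω, U 0 ω = x) →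
        (latticeLangevinDynamics (fundamentalLatticeRep 2) β').IsSolution (fundamentalRep (Fin 2))
          hW.natFiltration P W U →
        κ t x = P.map (U t)) :
    ∀ (l : List (ℝ≥0 × (GaugeConfig 3 L (Matrix.specialUnitaryGroup (Fin 2) ℂ) → ℝ))),
      (∀ p ∈ l, Measurable p.2) → (∀ p ∈ l, ∃ C : ℝ, ∀ z, |p.2 z| ≤ C) →
      ∀ {a b : GaugeConfig 3 L (Matrix.specialUnitaryGroup (Fin 2) ℂ) → ℝ},
        Measurable a → (∃ C : ℝ, ∀ z, |a z| ≤ C) → Measurable b → (∃ C : ℝ, ∀ z, |b z| ≤ C) →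
        ∫ y, a y * (l.foldr (fun p acc => fun y => ∫ z, p.2 z * acc z ∂(κ p.1 y)) b) y
            ∂(wilsonMeasure (d := 3) (L := L) (fundamentalRep (Fin 2)) β') =
          ∫ y, b y * (l.reverse.foldr (fun p acc => fun y => p.2 y * ∫ z, acc z ∂(κ p.1 y)) a) y
            ∂(wilsonMeasure (d := 3) (L := L) (fundamentalRep (Fin 2)) β')
  | [], _, _, a, b, _, _, _, _ => by
    simp only [List.foldr_nil, List.reverse_nil]
    exact integral_congr_ae (ae_of_all _ fun y => mul_comm _ _)
  | p :: l, hm, hb, a, b, ham, hab, hbm, hbb => by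
    have hml : ∀ q ∈ l, Measurable q.2 := fun q hq => hm q (List.mem_cons_of_mem _ hq)
    have hbl : ∀ q ∈ l, ∃ C : ℝ, ∀ z, |q.2 z| ≤ C := fun q hq => hb q (List.mem_cons_of_mem _ hq)
    have hpm : Measurable p.2 := hm p List.mem_cons_self
    obtain ⟨Cp, hCp⟩ := hb p List.mem_cons_self
    obtain ⟨Ca, hCa⟩ := hab
    -- the inner string `F = K M ⋯ b` is bounded measurable
    obtain ⟨hFm, CF, hCF⟩ := measurable_bounded_foldr_KM κ hbm hbb l hml hbl
    set F := l.foldr (fun p acc => fun y => ∫ z, p.2 z * acc z ∂(κ p.1 y)) b with hF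
    -- `K_t a` bounded measurable; `a' = f · K_t a`
    have hKam : Measurable fun y => ∫ z, a z ∂(κ p.1 y) := (ham.stronglyMeasurable.integral_kernel (κ := κ p.1)).measurable
    have hKab : ∀ y, |∫ z, a z ∂(κ p.1 y)| ≤ Ca := fun y => by
      have hh := norm_integral_le_of_norm_le_const (μ := κ p.1 y) (f := a) (C := Ca)
        (Eventually.of_forall fun z => by simpa [Real.norm_eq_abs] using hCa z)
      simpa [Real.norm_eq_abs] using hh
    have ha'm : Measurable fun y => p.2 y * ∫ z, a z ∂(κ p.1 y) := hpm.mul hKam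
    have ha'b : ∃ C : ℝ, ∀ y, |p.2 y * ∫ z, a z ∂(κ p.1 y)| ≤ C := ⟨Cp * Ca, fun y => by
      rw [abs_mul]; exact mul_le_mul (hCp y) (hKab y) (abs_nonneg _) ((abs_nonneg _).trans (hCp y))⟩
    -- step 1: one detailed-balance step `∫ a · K_t(f F) dμ = ∫ (f F) · K_t a dμ`
    have hfFm : Measurable fun y => p.2 y * F y := hpm.mul hFm
    have hfFb : ∃ C : ℝ, ∀ y, |p.2 y * F y| ≤ C := ⟨Cp * CF, fun y => by
      rw [abs_mul]; exact mul_le_mul (hCp y) (hCF y) (abs_nonneg _) ((abs_nonneg _).trans (hCp y))⟩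
    have h1 := integral_mul_transition_symm_su2_of_measurable L β' κ hreal p.1 ham ⟨Ca, hCa⟩ hfFm hfFb
    -- step 2: the induction hypothesis with the new head weight `a' = f · K_t a`
    have ih := integral_mul_foldr_transition_eq_reverse L β' κ hreal l hml hbl ha'm ha'b hbm hbb
    rw [List.foldr_cons, List.reverse_cons, List.foldr_append, List.foldr_cons, List.foldr_nil]
    calc ∫ y, a y * (∫ z, p.2 z * F z ∂(κ p.1 y)) ∂(wilsonMeasure (d := 3) (L := L) (fundamentalRep (Fin 2)) β')
        = ∫ y, (p.2 y * F y) * (∫ z, a z ∂(κ p.1 y)) ∂(wilsonMeasure (d := 3) (L := L) (fundamentalRep (Fin 2)) β') := h1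
      _ = ∫ y, (p.2 y * ∫ z, a z ∂(κ p.1 y)) * F y ∂(wilsonMeasure (d := 3) (L := L) (fundamentalRep (Fin 2)) β') :=
          integral_congr_ae (ae_of_all _ fun y => by ring)
      _ = _ := ih

/-- ★★ **Reversibility of the stationary SZZ process.**  With `b = 1` and head weight `a = f₀`: the stationary multi-time correlation
`E_μ[f₀(X_0)·f₁(X_(t₁))⋯f_n(X_(t₁+⋯+t_n))] = ∫ f₀·(K_(t₁)f₁⋯K_(t_n)f_n 1) dμ_(β')` equals the correlation of the time-reversed itinerary
`∫ (M_(f_n)K_(t_n)⋯M_(f₁)K_(t₁) f₀) dμ_(β')` — the Wilson–Gibbs-stationary lattice Langevin process is invariant under time reversal. [folklore] -/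
theorem stationary_fdd_reverse (L : ℕ) [NeZero L] (β' : ℝ)
    (κ : ℝ≥0 → Kernel (GaugeConfig 3 L (Matrix.specialUnitaryGroup (Fin 2) ℂ))
      (GaugeConfig 3 L (Matrix.specialUnitaryGroup (Fin 2) ℂ))) [∀ t, IsMarkovKernel (κ t)]
    (hreal : ∀ (t : ℝ≥0) (x : GaugeConfig 3 L (Matrix.specialUnitaryGroup (Fin 2) ℂ))
        (Ω : Type) [MeasurableSpace Ω] (P : Measure Ω) [IsProbabilityMeasure P]
        (W : ℝ≥0 → Ω → (Edge 3 L × NoiseIdx 2 → ℝ)) (hW : IsFlatBrownian W P)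
        (U : ℝ≥0 → Ω → GaugeConfig 3 L (Matrix.specialUnitaryGroup (Fin 2) ℂ)),
        (∀ ω, U 0 ω = x) →
        (latticeLangevinDynamics (fundamentalLatticeRep 2) β').IsSolution (fundamentalRep (Fin 2))
          hW.natFiltration P W U →
        κ t x = P.map (U t))
    (l : List (ℝ≥0 × (GaugeConfig 3 L (Matrix.specialUnitaryGroup (Fin 2) ℂ) → ℝ)))
    (hm : ∀ p ∈ l, Measurable p.2) (hb : ∀ p ∈ l, ∃ C : ℝ, ∀ z, |p.2 z| ≤ C)
    {f₀ : GaugeConfig 3 L (Matrix.specialUnitaryGroup (Fin 2) ℂ) → ℝ} (hf₀ : Measurable f₀) (hf₀b : ∃ C : ℝ, ∀ z, |f₀ z| ≤ C) :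
    ∫ y, f₀ y * (l.foldr (fun p acc => fun y => ∫ z, p.2 z * acc z ∂(κ p.1 y))
        (fun _ : GaugeConfig 3 L (Matrix.specialUnitaryGroup (Fin 2) ℂ) => (1 : ℝ))) y ∂(wilsonMeasure (d := 3) (L := L) (fundamentalRep (Fin 2)) β') =
      ∫ y, (l.reverse.foldr (fun p acc => fun y => p.2 y * ∫ z, acc z ∂(κ p.1 y)) f₀) y ∂(wilsonMeasure (d := 3) (L := L) (fundamentalRep (Fin 2)) β') := by
  have h := integral_mul_foldr_transition_eq_reverse L β' κ hreal l hm hb hf₀ hf₀b (b := fun _ => (1 : ℝ)) measurable_const ⟨1, fun _ => by simp⟩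
  simpa using h

end Summit.QuantumFields.YangMills.Theorems.ColdStartUniversality

end
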